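import Mathlib
import Summits.CriticalPhenomena.CardyFormulaZ2.Theorems.CardySelfRefinementDefs
import Summits.CriticalPhenomena.CardyFormulaZ2.Theorems.CardySelfRefinementGradientComparabilityStubBoundaryValuesCoupling
import Summits.CriticalPhenomena.CardyFormulaZ2.Theorems.CardySelfRefinementGradientComparabilityStubBoundaryValuesHi
import Literature.Probability.Percolation.SelfRefinementMeasure
import HarnessLib

/-!
# Crux `GradientComparability` (stmt-CriticalPhenomena-10269), line `monotone-product-coordinates` —
# support for stub `stub_cornerPatch`: the law of the two-sub-edge shadow of `M_k(ρ, c)`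
# (for `k = 2`: the coarse bundle configuration is Bernoulli bond percolation on `ℤ²`)

Route `CardySelfRefinement`, sub-problem `CriticalPhenomena/CardyFormulaZ2`; vocabulary from
`CardySelfRefinementDefs` (`M`, `cfg`, `prm`).

Dictionary for the slice `{c = 0}` of the corner patch (there the model is Bernoulli bond
percolation on the COARSE lattice `kℤ²`, a coarse edge being usable iff all its `k` sub-edges are
open).  Read a configuration `ω` of `ℤ²` through the coarse edges `{kC, kC + k e_d}` of `kℤ²`,
declaring `(C, d)` present iff the first two sub-edges `{kC, kC + e_d}`, `{kC + e_d, kC + 2e_d}` are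
both in `ω`.  Under `M_k(ρ, c)` (`k ≥ 2`, any `ρ, c`) this shadow, relabelled by `edgeConfig`, is
distributed as `bondPercolation (zdGraph 2) q(ρ)` with `q(ρ) = ρ̂/2 + (1 - ρ̂)/4`, `ρ̂ = projIcc 0 1 ρ`
(`M_map_twoSubedgeShadow`): on the coin side the shadow is the block read-out
`(selector ∧ shared) ∨ (¬ selector ∧ own₀ ∧ own₁)` of `prodBernoulli_map_coarseShadow`
(`…StubBoundaryValuesCoupling`), by the sub-edge dictionary `subedge_h_open_iff` /
`subedge_v_open_iff`.  For `k = 2` the two sub-edges ARE the bundle, so this is the full statement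
"the coarse bundle configuration of `M_2(ρ, c)` is Bernoulli bond percolation on `ℤ²` with
parameter `(1 + ρ̂)/4`" (`M_two_map_bundleConfig`; critical `1/2` exactly at `ρ = 1`).
-/

noncomputable section

namespace Summit.CriticalPhenomena.CardyFormulaZ2.Theorems.CardySelfRefinement

open scoped Topology
open Filter Set MeasureTheory
open Literature.Probability.LatticeModels Literature.Probability.Percolation
open Literature.Probability.Percolation.QuadCrossing
open Summit.CriticalPhenomena.CardyFormulaZ2.Theses.CardySelfRefinement

/-- The two-sub-edge shadow read-out is measurable. -/
theorem measurable_twoSubedgeShadow (k : ℕ) :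
    Measurable (fun ω : BondConfig (Site 2) => edgeConfig {t : Site 2 × Fin 2 |
      if t.2 = 0 then
        (s((![(k : ℤ) * t.1 0, (k : ℤ) * t.1 1] : Site 2), ![(k : ℤ) * t.1 0 + 1, (k : ℤ) * t.1 1]) ∈ ω ∧
          s((![(k : ℤ) * t.1 0 + 1, (k : ℤ) * t.1 1] : Site 2),
            ![(k : ℤ) * t.1 0 + 1 + 1, (k : ℤ) * t.1 1]) ∈ ω)
      else
        (s((![(k : ℤ) * t.1 0, (k : ℤ) * t.1 1] : Site 2), ![(k : ℤ) * t.1 0, (k : ℤ) * t.1 1 + 1]) ∈ ω ∧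
          s((![(k : ℤ) * t.1 0, (k : ℤ) * t.1 1 + 1] : Site 2),
            ![(k : ℤ) * t.1 0, (k : ℤ) * t.1 1 + 1 + 1]) ∈ ω)}) := by
  refine measurable_edgeConfig.comp (measurable_set_iff.2 fun t => ?_)
  by_cases h : t.2 = 0
  · simp only [mem_setOf_eq, h, ↓reduceIte]
    exact (measurable_set_mem _).and (measurable_set_mem _)
  · simp only [mem_setOf_eq, h, ↓reduceIte]
    exact (measurable_set_mem _).and (measurable_set_mem _)

/-- **The two-sub-edge shadow of `M_k(ρ, c)` is Bernoulli bond percolation with parameter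
`q(ρ) = ρ̂/2 + (1 - ρ̂)/4`** (`k ≥ 2`, any `ρ, c`): push `M_k(ρ,c) = (prodBernoulli prm).map cfg`
through the read-out; on the coin side the composite is the block read-out of
`prodBernoulli_map_coarseShadow` (sub-edge dictionary `subedge_h_open_iff`, `subedge_v_open_iff`). -/
theorem M_map_twoSubedgeShadow {k : ℕ} (hk : 2 ≤ k) (ρ c : ℝ) :
    (M k ρ c).map (fun ω : BondConfig (Site 2) => edgeConfig {t : Site 2 × Fin 2 |
      if t.2 = 0 then
        (s((![(k : ℤ) * t.1 0, (k : ℤ) * t.1 1] : Site 2), ![(k : ℤ) * t.1 0 + 1, (k : ℤ) * t.1 1]) ∈ ω ∧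
          s((![(k : ℤ) * t.1 0 + 1, (k : ℤ) * t.1 1] : Site 2),
            ![(k : ℤ) * t.1 0 + 1 + 1, (k : ℤ) * t.1 1]) ∈ ω)
      else
        (s((![(k : ℤ) * t.1 0, (k : ℤ) * t.1 1] : Site 2), ![(k : ℤ) * t.1 0, (k : ℤ) * t.1 1 + 1]) ∈ ω ∧
          s((![(k : ℤ) * t.1 0, (k : ℤ) * t.1 1 + 1] : Site 2),
            ![(k : ℤ) * t.1 0, (k : ℤ) * t.1 1 + 1 + 1]) ∈ ω)}) =
      bondPercolation (zdGraph 2) ⟨_, shadowParam_mem ρ⟩ := by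
  -- the coin-side block read-out of `prodBernoulli_map_coarseShadow`
  set T : Set (Site 2 × Fin 2 × Fin 3) → Set (Site 2 × Fin 2) := fun S =>
    {t | ((t.1, t.2, (2 : Fin 3)) ∈ S ∧ (t.1, t.2, (1 : Fin 3)) ∈ S) ∨
      ((t.1, t.2, (2 : Fin 3)) ∉ S ∧
        (((![(k : ℤ) * t.1 0, (k : ℤ) * t.1 1] : Site 2), t.2, (0 : Fin 3)) ∈ S ∧
        (((![(k : ℤ) * t.1 0, (k : ℤ) * t.1 1] : Site 2) +
          (if t.2 = 0 then ![1, 0] else ![0, 1]), t.2, (0 : Fin 3)) ∈ S)))}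
  have hT : ∀ S t, t ∈ T S ↔ ((t.1, t.2, (2 : Fin 3)) ∈ S ∧ (t.1, t.2, (1 : Fin 3)) ∈ S) ∨
      ((t.1, t.2, (2 : Fin 3)) ∉ S ∧
        (((![(k : ℤ) * t.1 0, (k : ℤ) * t.1 1] : Site 2), t.2, (0 : Fin 3)) ∈ S ∧
        (((![(k : ℤ) * t.1 0, (k : ℤ) * t.1 1] : Site 2) +
          (if t.2 = 0 then ![1, 0] else ![0, 1]), t.2, (0 : Fin 3)) ∈ S))) := fun S t => Iff.rfl
  rw [M_eq_selfRefinementMeasure, selfRefinementMeasure,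
    Measure.map_map (measurable_twoSubedgeShadow k) (measurable_refinementConfig k),
    ← prm_eq_refinementParam, prm_eq_refinementParam]
  rw [← prodBernoulli_map_coarseShadow hk ρ c T hT]
  congr 1
  funext S
  simp only [Function.comp_apply]
  congr 1
  ext ⟨C, d⟩
  simp only [mem_setOf_eq]
  have e0 : (![(k : ℤ) * C 0, (k : ℤ) * C 1] : Site 2) + ![1, 0] = ![(k : ℤ) * C 0 + 1, (k : ℤ) * C 1] := by
    ext j; fin_cases j <;> simp
  have e1 : (![(k : ℤ) * C 0, (k : ℤ) * C 1] : Site 2) + ![0, 1] = ![(k : ℤ) * C 0, (k : ℤ) * C 1 + 1] := by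
    ext j; fin_cases j <;> simp
  fin_cases d
  · simp only [Fin.zero_eta, Fin.isValue, ↓reduceIte]
    rw [subedge_h_open_iff hk S C (Or.inl rfl), subedge_h_open_iff hk S C (Or.inr rfl), hT]
    simp only [Fin.isValue, ↓reduceIte, e0]
    tauto
  · simp only [Fin.mk_one, Fin.isValue, one_ne_zero, ↓reduceIte]
    rw [subedge_v_open_iff hk S C (Or.inl rfl), subedge_v_open_iff hk S C (Or.inr rfl), hT]
    simp only [Fin.isValue, one_ne_zero, ↓reduceIte, e1]
    tauto

/-- **For `k = 2`: the coarse bundle configuration of `M_2(ρ, c)` is Bernoulli bond percolation on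
`ℤ²` with parameter `ρ̂/2 + (1 - ρ̂)/4 = (1 + ρ̂)/4`** (a bundle of `M_2` has exactly the two
sub-edges read by the shadow; with probability `ρ̂` both copy one fair coin, with probability
`1 - ρ̂` they are independent fair coins).  On the slice `{c = 0}` (all interior edges closed) this
is the coarse Bernoulli model through which the corner patch reads Kesten's window; `ρ = 1` is its
critical point `1/2`. -/
theorem M_two_map_bundleConfig (ρ c : ℝ) :
    (M 2 ρ c).map (fun ω : BondConfig (Site 2) => edgeConfig {t : Site 2 × Fin 2 |
      if t.2 = 0 then
        (s((![((2 : ℕ) : ℤ) * t.1 0, ((2 : ℕ) : ℤ) * t.1 1] : Site 2),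
            ![((2 : ℕ) : ℤ) * t.1 0 + 1, ((2 : ℕ) : ℤ) * t.1 1]) ∈ ω ∧
          s((![((2 : ℕ) : ℤ) * t.1 0 + 1, ((2 : ℕ) : ℤ) * t.1 1] : Site 2),
            ![((2 : ℕ) : ℤ) * t.1 0 + 1 + 1, ((2 : ℕ) : ℤ) * t.1 1]) ∈ ω)
      else
        (s((![((2 : ℕ) : ℤ) * t.1 0, ((2 : ℕ) : ℤ) * t.1 1] : Site 2),
            ![((2 : ℕ) : ℤ) * t.1 0, ((2 : ℕ) : ℤ) * t.1 1 + 1]) ∈ ω ∧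
          s((![((2 : ℕ) : ℤ) * t.1 0, ((2 : ℕ) : ℤ) * t.1 1 + 1] : Site 2),
            ![((2 : ℕ) : ℤ) * t.1 0, ((2 : ℕ) : ℤ) * t.1 1 + 1 + 1]) ∈ ω)}) =
      bondPercolation (zdGraph 2) ⟨_, shadowParam_mem ρ⟩ :=
  M_map_twoSubedgeShadow le_rfl ρ c

end Summit.CriticalPhenomena.CardyFormulaZ2.Theorems.CardySelfRefinement

end
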